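import Summits.QuantumFields.YangMills.Theorems.BalabanUVNodesClusters
import Literature.MathematicalPhysics.QuantumFieldTheory.Balaban1983to89.B16NodeKnitRecord9
import Literature.MathematicalPhysics.QuantumFieldTheory.Balaban1983to89.Node00.Record9InhabitedSU1
import Literature.MathematicalPhysics.QuantumFieldTheory.Balaban1983to89.B16NodeKnitRecord10

/-!
# BalabanUVNodes ∕ N13 at the Stage-9 record, θ-KEYED — the v1.3 companion of `BalabanUVNodesN13AtRecord` (★ dag-ref-B READ-280 REPAIR): the K2 route stub
# `YMDAG.UVSplit.S_N13 Rec` ([Balaban1989LargeFieldII] Thm 1 p. 355 + (0.1), Cor. 3 pp. 387 ∕ 391; `Dag.B16_main`) for record predicates refining NODE 00's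
# `IsRecordOfRecord₉C`, from law slots KEYED TO THE RECORD'S OWN PARAMETERS; and the CENSUS in kernel form of the UNIVERSAL ₉C-law slot (Track A, DAG node N13;
# cluster K2 «FlowBounds»; KNIT-BY-NAME seat `pub-ymgap-dag-n13-a`, g5; count-neutral)

HONEST FRAMING.  Count-neutral kernel BOOKKEEPING over landed theorems, by name.  `BalabanUVNodesN13AtRecord` §6 (v1.2) closed `S_N13 (₉C)` from a hypothesis `slots`
quantified over ALL admissible `θ : Stage9Params F N` with provisos; dag-ref-B READ-280 (vacuity audit A2 ∕ A5) located that this hypothesis ranges over the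
residual-swapped sisters (`ScorrLaw ≡ ⊤`, `S218 ≡ ⊥`) of any inhabitant — `Stage9Params.Admissible` ∕ `.Provisos` constrain no residual law (`Node00/Record5` :117,
`Record9` :116 ∕ :297) —, at which (R₉) `TLaw₉ … 0 → SLaw₉ … 1` reads `⊤ → ⊥`; so it is REFUTABLE at every inhabited `N` and the §6 closers carry no content.  THIS FILE:
§1 the SOUND SHAPE — law slots keyed to the parameters that WITNESS a `Rec`-record (`∀ F D w, Rec F D w → ∀ θ h, ⟨₉C witness clause of (D, w) at θ⟩ → ∀ P, (R₉) ∧ (UV₉)`),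
which carries content exactly over refinements `Rec` that PIN the residual laws (the successor records ₉⁺ ∕ `Record11` (S), DEDUP №11) — module 14's `b16_main_at_record₉`
BY NAME per record world; §2 the CENSUS — the universal slot is FALSE given ONE admissible `θ₀` with provisos (`not_slots₉C_of_inhabited`, residual swap by structure update,
`Admissible` ∕ `Provisos` transported by `rfl` ∕ field by field), at `N = 1` UNCONDITIONALLY through the tree's inhabitant `Node00.Record9InhabitedSU1.exists_admissible_provisos_SU1`
(seat dag-n23-b; the degenerate corner) (`not_slots₉C_SU1`); and over `Rec := ₉C` ITSELF even the keyed slot is FALSE given one inhabitant (`not_keyedSlots_rec₉C_of_inhabited` ∕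
`_SU1`: junk-law parameters WITNESS their own Stage-9 records, `Node00.isRecordOfRecord₉C_of_eq`) — vacuity STATED (A5), not hidden.  N13 is NOT discharged; nothing of
Bałaban's is asserted or re-derived; one finite four-torus programme at fixed `ε`; nothing continuum ∕ ℝ⁴ ∕ OS ∕ mass-gap ∕ Clay.  0 `def`, 0 `sorry`, standard axioms.
Filed `--supports stmt-QuantumFields-19183` (pub-ymgap dag-lead WORDS-84: the READ-280 repair; split from the v1.3 append by the 400-line lint on Theorems files).

v1.1 (§3, trigger `Node00/Record10` p429207 ✓): THE SAME AT NODE 00's STAGE-10 RECORD `IsRecordOfRecord₁₀C` — `s_N13_of_refines₁₀C_of_laws_keyed` (READ-280's sound shape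
with `Provisos₁₀`, `datumOfRecord₁₀`, `toStage5₁₀`, `SLaw₁₀ ∕ TLaw₁₀`, χ face `chiFixed7`; module 16 `B16NodeKnitRecord10.b16_main_at_record₁₀` per record world) and the A5 census
`not_keyedSlots_rec₁₀C_of_inhabited` (at ₁₀ the laws are still residual: given one admissible `θ₀` with `Provisos₁₀`, the keyed slot over `Rec := ₁₀C` itself is FALSE — the
residual-swapped sister keeps `Provisos₁₀` field by field, `contT` included; no `N = 1` twin is stated until a Stage-10 inhabitant lands); §4 the EXISTENTIALLY-keyed shape `s_N13_of_laws_exists₉ ∕ ₁₀` (dag-ref-B READ-296's reading pin: the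
record names SOME law-abiding ₉∕₁₀-presentation carrying (R) ∧ (UV) — the form in which the `TLaw → SLaw` transport is genuine; no sisters quantified, no `href`).

BY NAME and UNCHANGED: `…B16NodeKnitRecord10` (module 16: `b16_main_at_record₁₀`), `…Node00.Record10` (`Stage9Params.Provisos₁₀`, `datumOfRecord₁₀`, `toStage5₁₀`, `SLaw₁₀`,
`TLaw₁₀`, `IsRecordOfRecord₁₀C`, `isRecordOfRecord₁₀C_of_eq`), `…B16NodeKnitRecord9` (module 14: `b16_main_at_record₉`; its `_forall_` form carries the same universal slot), `…Node00.Record9` (`Stage9Params`,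
`.Provisos`, `.Admissible`, `.gamma_pos`, `datumOfRecord₉`, `upOfRecord₅C`, `Stage9Params.toStage5`, `SLaw₉`, `TLaw₉`, `IsRecordOfRecord₉C`, `isRecordOfRecord₉C_of_eq`),
`…Node00.Record9InhabitedSU1` (`exists_admissible_provisos_SU1`), `…Node00.Satisfiable` (`nonempty_worldP`), `…BalabanUVNodesClustersCore` (`RecordPred`, `Datum`, `S_N13`).
Sources: T. Bałaban, CMP **122** (1989) 355–392 [Balaban1989LargeFieldII] Thm 1 p. 355, (0.1) pp. 355–356, p. 387, p. 391; CMP **119** (1988) 243–285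
[Balaban1988Convergent] p. 244, (2.18) p. 257, Cor. 3 (2.50) p. 264.
-/

noncomputable section

open scoped BigOperators

namespace Summit.QuantumFields.YangMills.BalabanUVNodes.N13AtRecord9Keyed

open Literature.MathematicalPhysics.QuantumFieldTheory.Balaban1983to89
open Literature.MathematicalPhysics.QuantumFieldTheory.Balaban1983to89.T4Continuum
open Literature.MathematicalPhysics.QuantumFieldTheory.Balaban1983to89.DagBinding
open Literature.MathematicalPhysics.QuantumFieldTheory.Balaban1983to89.Node00
open Literature.MathematicalPhysics.QuantumFieldTheory.Balaban1983to89.FlowStepRuns (genFlow genSeq)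
open YMDAG.UVSplit (RecordPred Datum S_N13)

variable {N : ℕ} [NeZero N]

/-! ## §1 The ₉C-law slot KEYED TO THE RECORD'S OWN PARAMETERS (dag-ref-B READ-280's SOUND SHAPE) -/

/-- **`S_N13 Rec` FOR EVERY `Rec` REFINING THE STAGE-9 RECORD, FROM LAW SLOTS KEYED TO THE RECORD'S OWN PARAMETERS** (dag-ref-B READ-280's SOUND SHAPE
`∀ F D w, Rec F D w → ∀ θ h, ⟨₉C witness clause of (D, w) at θ⟩ → ∀ P, (R₉) ∧ (UV₉)`): the hypothesis `slots` asks N13's two products — (R₉) law transport by 𝐑 along the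
tower `∀ k < P.K, TLaw₉ … k → SLaw₉ … (k+1)` and (UV₉) (0.1) pointwise on `densOfRecord₉` for §2-format levels below `w.γ` — ONLY at parameters `θ, h` that WITNESS a
`Rec`-record `(F, D, w)` (all six clauses of `IsRecordOfRecord₉C F N D w` as premises: admissibility, `D = datumOfRecord₉ F N θ h`, `w.C = D.C`, the window `0 < w.γ ≤ θ.γ`,
`w.L = θ.L`, the C-binding `w.up P = upOfRecord₅C F N (θ.toStage5 F N) P`).  Hence for a `Rec` that PINS the residual laws (the successor records ₉⁺ ∕ `Record11` (S), DEDUP №11)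
`slots` no longer ranges over residual-swapped sisters; over `Rec := ₉C` ITSELF it is still refutable at every inhabited `N` (`not_keyedSlots_rec₉C_of_inhabited`: junk-law
parameters witness their own ₉C records).  Module 14's `B16NodeKnitRecord9.b16_main_at_record₉` BY NAME per record world; count-neutral; NOT a discharge.
[cite: Balaban1989LargeFieldII, Thm 1 p.355, (0.1) pp.355–356, p.387, p.391; Balaban1988Convergent, p.244, (2.18) p.257, Cor. 3 (2.50) p.264] -/
theorem s_N13_of_refines₉C_of_laws_keyed (Rec : RecordPred N)
    (href : ∀ (F : T4Family) (D : Datum F N) (w : WorldP), Rec F D w → IsRecordOfRecord₉C F N D w)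
    (slots : ∀ (F : T4Family) (D : Datum F N) (w : WorldP), Rec F D w →
      ∀ (θ : Stage9Params F N) (h : θ.Provisos), θ.Admissible → D = datumOfRecord₉ F N θ h → w.C = D.C → (0 < w.γ ∧ w.γ ≤ θ.γ) →
        w.L = (θ.L : ℝ) → (∀ P, w.up P = upOfRecord₅C F N (θ.toStage5 F N) P) → ∀ P : B12.RunParams,
        (∀ k, k < P.K → TLaw₉ F N θ P k → SLaw₉ F N θ P (k + 1)) ∧
        ((genFlow (betaOfRecord₉ F N θ) P.g0).InInterval w.γ P.K → ∀ k, k ≤ P.K → SLaw₉ F N θ P k →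
          ∀ U : GaugeField (F.P P.K) k (SU N),
            chiOfRecord F N θ.ν (gOfRecord₉ F N θ P) P.K k U *
                  Real.exp (-(1 / (gOfRecord₉ F N θ P k) ^ 2 * wilsonBGOfRecord F N θ.εbg P k U)
                    - w.em (gOfRecord₉ F N θ P k) * (Fintype.card (Site (F.P P.K) k) : ℝ)) ≤ densOfRecord₉ F N θ P k U ∧
            densOfRecord₉ F N θ P k U ≤ Real.exp (w.ep (gOfRecord₉ F N θ P k) * (Fintype.card (Site (F.P P.K) k) : ℝ)))) :
    S_N13 Rec := by
  intro F D w hR P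
  obtain ⟨θ, h, hθ, hD, hC, hγ, hL, hup⟩ := href F D w hR
  obtain ⟨hR9, hUV9⟩ := slots F D w hR θ h hθ hD hC hγ hL hup P
  exact B16NodeKnitRecord9.b16_main_at_record₉ F N θ w P h (by rw [hC, hD]) (hup P) hR9 le_rfl hUV9

/-- **The instance `Rec := IsRecordOfRecord₉C`** of `s_N13_of_refines₉C_of_laws_keyed` (dag-lead WORDS-84's name).  VACUITY STATED (A5): over ₉C ITSELF the keyed
hypothesis is still FALSE at every inhabited `N` (§2 `not_keyedSlots_rec₉C_of_inhabited`; at `N = 1` unconditionally, `not_keyedSlots_rec₉C_SU1`) — the Stage-9 record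
class contains the residual-swapped junk-law records; content only over refinements that pin the laws (₉⁺ ∕ `Record11` (S)), for which use the generic form.
[cite: Balaban1989LargeFieldII, Thm 1 p.355, (0.1) pp.355–356, p.387, p.391 (bookkeeping)] -/
theorem s_N13_rec₉C_of_laws_keyed
    (slots : ∀ (F : T4Family) (D : Datum F N) (w : WorldP), IsRecordOfRecord₉C F N D w →
      ∀ (θ : Stage9Params F N) (h : θ.Provisos), θ.Admissible → D = datumOfRecord₉ F N θ h → w.C = D.C → (0 < w.γ ∧ w.γ ≤ θ.γ) →
        w.L = (θ.L : ℝ) → (∀ P, w.up P = upOfRecord₅C F N (θ.toStage5 F N) P) → ∀ P : B12.RunParams,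
        (∀ k, k < P.K → TLaw₉ F N θ P k → SLaw₉ F N θ P (k + 1)) ∧
        ((genFlow (betaOfRecord₉ F N θ) P.g0).InInterval w.γ P.K → ∀ k, k ≤ P.K → SLaw₉ F N θ P k →
          ∀ U : GaugeField (F.P P.K) k (SU N),
            chiOfRecord F N θ.ν (gOfRecord₉ F N θ P) P.K k U *
                  Real.exp (-(1 / (gOfRecord₉ F N θ P k) ^ 2 * wilsonBGOfRecord F N θ.εbg P k U)
                    - w.em (gOfRecord₉ F N θ P k) * (Fintype.card (Site (F.P P.K) k) : ℝ)) ≤ densOfRecord₉ F N θ P k U ∧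
            densOfRecord₉ F N θ P k U ≤ Real.exp (w.ep (gOfRecord₉ F N θ P k) * (Fintype.card (Site (F.P P.K) k) : ℝ)))) :
    S_N13 (fun F D w => IsRecordOfRecord₉C F N D w) :=
  s_N13_of_refines₉C_of_laws_keyed (fun F D w => IsRecordOfRecord₉C F N D w) (fun _ _ _ h => h) slots

/-! ## §2 The CENSUS in kernel form: the universal ₉C-law slot of `N13AtRecord` §6 ∕ module 14's `_forall_` form, and the keyed slot over ₉C itself -/

/-- **CENSUS (dag-ref-B READ-280 in kernel form): `N13AtRecord` §6's UNIVERSAL ₉C-LAW SLOT IS FALSE ON EVERY FAMILY CARRYING ONE INHABITANT.**  Given ONE admissible `θ₀ : Stage9Params F N`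
with provisos, the residual-swapped sister `θ′ := {θ₀ with ScorrLaw := ⊤, res.S218 := ⊥}` is again admissible with provisos (`Stage9Params.Admissible` ∕ `.Provisos`
constrain no residual law — `rfl` ∕ field by field), the world bound to its datum over its Stage-9 view is a world the slot quantifies over, and at the run `(K, m, g₀) = (1, m, 1)`
(R₉) at `k = 0` reads `⊤ → ⊥`.  The F-n24T-1 pattern of `N13AtRecord` §3 through the residual LAWS instead of `res.V`; the same hypothesis is module 14's `B16NodeKnitRecord9.b16_main_forall_isRecordOfRecord₉C`'s `slots` read at one family. [cite: Balaban1988Convergent, p.244; Balaban1989LargeFieldII, Thm 1 p.355 (bookkeeping census)] -/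
theorem not_slots₉C_of_inhabited {F : T4Family} (θ₀ : Stage9Params F N) (h₀ : θ₀.Provisos) (hθ₀ : θ₀.Admissible) :
    ¬ ∀ (θ : Stage9Params F N) (h : θ.Provisos), θ.Admissible → ∀ w : WorldP, w.C = (datumOfRecord₉ F N θ h).C →
      (∀ P, w.up P = upOfRecord₅C F N (θ.toStage5 F N) P) → ∀ P : B12.RunParams,
        (∀ k, k < P.K → TLaw₉ F N θ P k → SLaw₉ F N θ P (k + 1)) ∧
        ((genFlow (betaOfRecord₉ F N θ) P.g0).InInterval w.γ P.K → ∀ k, k ≤ P.K → SLaw₉ F N θ P k →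
          ∀ U : GaugeField (F.P P.K) k (SU N),
            chiOfRecord F N θ.ν (gOfRecord₉ F N θ P) P.K k U *
                  Real.exp (-(1 / (gOfRecord₉ F N θ P k) ^ 2 * wilsonBGOfRecord F N θ.εbg P k U)
                    - w.em (gOfRecord₉ F N θ P k) * (Fintype.card (Site (F.P P.K) k) : ℝ)) ≤ densOfRecord₉ F N θ P k U ∧
            densOfRecord₉ F N θ P k U ≤ Real.exp (w.ep (gOfRecord₉ F N θ P k) * (Fintype.card (Site (F.P P.K) k) : ℝ))) := by
  intro slots
  let θ' : Stage9Params F N :=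
    { θ₀ with ScorrLaw := fun _ _ _ => True, res := { θ₀.res with S218 := fun _ _ _ => False } }
  have hθ' : θ'.Admissible := hθ₀
  have h' : θ'.Provisos := ⟨h₀.intPiece, h₀.measω, h₀.measChi, h₀.zetaUnity, h₀.zetaAbs, h₀.rstep⟩
  obtain ⟨w₀⟩ := nonempty_worldP
  exact (slots θ' h' hθ' { w₀ with C := (datumOfRecord₉ F N θ' h').C, up := fun P => upOfRecord₅C F N (θ'.toStage5 F N) P }
    rfl (fun _ => rfl) ⟨1, F.m, 1⟩).1 0 Nat.one_pos True.intro

/-- **… at `N = 1`, UNCONDITIONALLY** (the tree's inhabitant `Node00.Record9InhabitedSU1.exists_admissible_provisos_SU1`, seat dag-n23-b — the DEGENERATE corner; an inhabitant at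
`2 ≤ N` is K0 of record): §6's hypothesis `slots` (quantified over all families) is FALSE — read at any family `F`. [cite: Balaban1988Convergent, p.244 (bookkeeping census)] -/
theorem not_slots₉C_SU1 (F : T4Family) :
    ¬ ∀ (F' : T4Family) (θ : Stage9Params F' 1) (h : θ.Provisos), θ.Admissible → ∀ w : WorldP, w.C = (datumOfRecord₉ F' 1 θ h).C →
      (∀ P, w.up P = upOfRecord₅C F' 1 (θ.toStage5 F' 1) P) → ∀ P : B12.RunParams,
        (∀ k, k < P.K → TLaw₉ F' 1 θ P k → SLaw₉ F' 1 θ P (k + 1)) ∧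
        ((genFlow (betaOfRecord₉ F' 1 θ) P.g0).InInterval w.γ P.K → ∀ k, k ≤ P.K → SLaw₉ F' 1 θ P k →
          ∀ U : GaugeField (F'.P P.K) k (SU 1),
            chiOfRecord F' 1 θ.ν (gOfRecord₉ F' 1 θ P) P.K k U *
                  Real.exp (-(1 / (gOfRecord₉ F' 1 θ P k) ^ 2 * wilsonBGOfRecord F' 1 θ.εbg P k U)
                    - w.em (gOfRecord₉ F' 1 θ P k) * (Fintype.card (Site (F'.P P.K) k) : ℝ)) ≤ densOfRecord₉ F' 1 θ P k U ∧
            densOfRecord₉ F' 1 θ P k U ≤ Real.exp (w.ep (gOfRecord₉ F' 1 θ P k) * (Fintype.card (Site (F'.P P.K) k) : ℝ))) := by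
  intro slots
  obtain ⟨θ₀, hθ₀, h₀, -⟩ := exists_admissible_provisos_SU1 F 1 one_pos
  exact not_slots₉C_of_inhabited θ₀ h₀ hθ₀ (slots F)

/-- **CENSUS OF THE KEYED SLOT OVER ₉C ITSELF**: given ONE admissible `θ₀ : Stage9Params F N` with provisos, the hypothesis of §1's `s_N13_rec₉C_of_laws_keyed` is FALSE — the
residual-swapped sister `θ′` WITNESSES ITS OWN Stage-9 record `(datumOfRecord₉ F N θ′ h′, w′)` (`Node00.isRecordOfRecord₉C_of_eq`), at which the keyed (R₉) reads `⊤ → ⊥` at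
`k = 0`.  So over `Rec := ₉C` the keyed closer is as vacuous as `N13AtRecord` §6's; its content is over law-pinning refinements only (vacuity STATED, A5).
[cite: Balaban1988Convergent, p.244; Balaban1989LargeFieldII, Thm 1 p.355 (bookkeeping census)] -/
theorem not_keyedSlots_rec₉C_of_inhabited {F : T4Family} (θ₀ : Stage9Params F N) (h₀ : θ₀.Provisos) (hθ₀ : θ₀.Admissible) :
    ¬ ∀ (F' : T4Family) (D : Datum F' N) (w : WorldP), IsRecordOfRecord₉C F' N D w →
      ∀ (θ : Stage9Params F' N) (h : θ.Provisos), θ.Admissible → D = datumOfRecord₉ F' N θ h → w.C = D.C → (0 < w.γ ∧ w.γ ≤ θ.γ) →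
        w.L = (θ.L : ℝ) → (∀ P, w.up P = upOfRecord₅C F' N (θ.toStage5 F' N) P) → ∀ P : B12.RunParams,
        (∀ k, k < P.K → TLaw₉ F' N θ P k → SLaw₉ F' N θ P (k + 1)) ∧
        ((genFlow (betaOfRecord₉ F' N θ) P.g0).InInterval w.γ P.K → ∀ k, k ≤ P.K → SLaw₉ F' N θ P k →
          ∀ U : GaugeField (F'.P P.K) k (SU N),
            chiOfRecord F' N θ.ν (gOfRecord₉ F' N θ P) P.K k U *
                  Real.exp (-(1 / (gOfRecord₉ F' N θ P k) ^ 2 * wilsonBGOfRecord F' N θ.εbg P k U)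
                    - w.em (gOfRecord₉ F' N θ P k) * (Fintype.card (Site (F'.P P.K) k) : ℝ)) ≤ densOfRecord₉ F' N θ P k U ∧
            densOfRecord₉ F' N θ P k U ≤ Real.exp (w.ep (gOfRecord₉ F' N θ P k) * (Fintype.card (Site (F'.P P.K) k) : ℝ))) := by
  intro slots
  let θ' : Stage9Params F N :=
    { θ₀ with ScorrLaw := fun _ _ _ => True, res := { θ₀.res with S218 := fun _ _ _ => False } }
  have hθ' : θ'.Admissible := hθ₀
  have h' : θ'.Provisos := ⟨h₀.intPiece, h₀.measω, h₀.measChi, h₀.zetaUnity, h₀.zetaAbs, h₀.rstep⟩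
  obtain ⟨w₀⟩ := nonempty_worldP
  have hL1 : (1 : ℝ) < (θ'.L : ℝ) := by exact_mod_cast θ'.hL.2
  let w : WorldP :=
    { w₀ with
      C := (datumOfRecord₉ F N θ' h').C, up := fun P => upOfRecord₅C F N (θ'.toStage5 F N) P, γ := θ'.γ,
      L := (θ'.L : ℝ), one_lt_L := hL1 }
  have hγ : 0 < w.γ ∧ w.γ ≤ θ'.γ := ⟨hθ'.gamma_pos, le_rfl⟩
  have hrec : IsRecordOfRecord₉C F N (datumOfRecord₉ F N θ' h') w :=
    isRecordOfRecord₉C_of_eq F N θ' h' hθ' w rfl hγ rfl (fun _ => rfl)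
  exact (slots F _ w hrec θ' h' hθ' rfl rfl hγ rfl (fun _ => rfl) ⟨1, F.m, 1⟩).1 0 Nat.one_pos True.intro

/-- **… at `N = 1`, UNCONDITIONALLY** (`Record9InhabitedSU1`): the hypothesis of `s_N13_rec₉C_of_laws_keyed` at `N = 1` is FALSE — read at any family `F`.
[cite: Balaban1988Convergent, p.244 (bookkeeping census)] -/
theorem not_keyedSlots_rec₉C_SU1 (F : T4Family) :
    ¬ ∀ (F' : T4Family) (D : Datum F' 1) (w : WorldP), IsRecordOfRecord₉C F' 1 D w →
      ∀ (θ : Stage9Params F' 1) (h : θ.Provisos), θ.Admissible → D = datumOfRecord₉ F' 1 θ h → w.C = D.C → (0 < w.γ ∧ w.γ ≤ θ.γ) →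
        w.L = (θ.L : ℝ) → (∀ P, w.up P = upOfRecord₅C F' 1 (θ.toStage5 F' 1) P) → ∀ P : B12.RunParams,
        (∀ k, k < P.K → TLaw₉ F' 1 θ P k → SLaw₉ F' 1 θ P (k + 1)) ∧
        ((genFlow (betaOfRecord₉ F' 1 θ) P.g0).InInterval w.γ P.K → ∀ k, k ≤ P.K → SLaw₉ F' 1 θ P k →
          ∀ U : GaugeField (F'.P P.K) k (SU 1),
            chiOfRecord F' 1 θ.ν (gOfRecord₉ F' 1 θ P) P.K k U *
                  Real.exp (-(1 / (gOfRecord₉ F' 1 θ P k) ^ 2 * wilsonBGOfRecord F' 1 θ.εbg P k U)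
                    - w.em (gOfRecord₉ F' 1 θ P k) * (Fintype.card (Site (F'.P P.K) k) : ℝ)) ≤ densOfRecord₉ F' 1 θ P k U ∧
            densOfRecord₉ F' 1 θ P k U ≤ Real.exp (w.ep (gOfRecord₉ F' 1 θ P k) * (Fintype.card (Site (F'.P P.K) k) : ℝ))) := by
  intro slots
  obtain ⟨θ₀, hθ₀, h₀, -⟩ := exists_admissible_provisos_SU1 F 1 one_pos
  exact not_keyedSlots_rec₉C_of_inhabited θ₀ h₀ hθ₀ slots


/-! ## §3 (v1.1) The same at NODE 00's STAGE-10 RECORD `IsRecordOfRecord₁₀C` (trigger `Node00/Record10`; module 16 `B16NodeKnitRecord10`) -/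

/-- **`S_N13 Rec` FOR EVERY `Rec` REFINING THE STAGE-10 RECORD, FROM LAW SLOTS KEYED TO THE RECORD'S OWN PARAMETERS** (READ-280's sound shape at ₁₀C): `slots` asks
(R₁₀) `∀ k < P.K, TLaw₁₀ … k → SLaw₁₀ … (k+1)` and (UV₁₀) (0.1) pointwise on `densOfRecord₁₀` (χ face `chiFixed7 F N θ.ν P.K (gOfRecord₁₀ F N θ P) k`) for §2-format levels
below `w.γ`, ONLY at parameters `θ, h` (`h : θ.Provisos₁₀`) that WITNESS a `Rec`-record (all six clauses of `IsRecordOfRecord₁₀C F N D w` as premises).  Content over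
refinements that PIN the residual laws (`Record11` (S), DEDUP №11); over `Rec := ₁₀C` itself still refutable given one inhabitant (`not_keyedSlots_rec₁₀C_of_inhabited`).
Module 16's `B16NodeKnitRecord10.b16_main_at_record₁₀` BY NAME per record world; count-neutral; NOT a discharge.
[cite: Balaban1989LargeFieldII, Thm 1 p.355, (0.1) pp.355–356, p.387, p.391; Balaban1988Convergent, p.244, (2.18) p.257, Cor. 3 (2.50) p.264] -/
theorem s_N13_of_refines₁₀C_of_laws_keyed (Rec : RecordPred N)
    (href : ∀ (F : T4Family) (D : Datum F N) (w : WorldP), Rec F D w → IsRecordOfRecord₁₀C F N D w)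
    (slots : ∀ (F : T4Family) (D : Datum F N) (w : WorldP), Rec F D w →
      ∀ (θ : Stage9Params F N) (h : θ.Provisos₁₀), θ.Admissible → D = datumOfRecord₁₀ F N θ h → w.C = D.C → (0 < w.γ ∧ w.γ ≤ θ.γ) →
        w.L = (θ.L : ℝ) → (∀ P, w.up P = upOfRecord₅C F N (θ.toStage5₁₀ F N) P) → ∀ P : B12.RunParams,
        (∀ k, k < P.K → TLaw₁₀ F N θ P k → SLaw₁₀ F N θ P (k + 1)) ∧
        ((genFlow (betaOfRecord₁₀ F N θ) P.g0).InInterval w.γ P.K → ∀ k, k ≤ P.K → SLaw₁₀ F N θ P k →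
          ∀ U : GaugeField (F.P P.K) k (SU N),
            chiFixed7 F N θ.ν P.K (gOfRecord₁₀ F N θ P) k U *
                  Real.exp (-(1 / (gOfRecord₁₀ F N θ P k) ^ 2 * wilsonBGOfRecord F N θ.εbg P k U)
                    - w.em (gOfRecord₁₀ F N θ P k) * (Fintype.card (Site (F.P P.K) k) : ℝ)) ≤ densOfRecord₁₀ F N θ P k U ∧
            densOfRecord₁₀ F N θ P k U ≤ Real.exp (w.ep (gOfRecord₁₀ F N θ P k) * (Fintype.card (Site (F.P P.K) k) : ℝ)))) :
    S_N13 Rec := by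
  intro F D w hR P
  obtain ⟨θ, h, hθ, hD, hC, hγ, hL, hup⟩ := href F D w hR
  obtain ⟨hR9, hUV9⟩ := slots F D w hR θ h hθ hD hC hγ hL hup P
  exact B16NodeKnitRecord10.b16_main_at_record₁₀ F N θ w P h (by rw [hC, hD]) (hup P) hR9 le_rfl hUV9

/-- **CENSUS OF THE KEYED SLOT OVER ₁₀C ITSELF (A5)**: given ONE admissible `θ₀ : Stage9Params F N` with `Provisos₁₀`, the hypothesis of `s_N13_of_refines₁₀C_of_laws_keyed` at
`Rec := IsRecordOfRecord₁₀C` is FALSE — at Stage 10 the laws `S218 ∕ ScorrLaw` are still RESIDUAL, so the residual-swapped sister `θ′ := {θ₀ with ScorrLaw := ⊤, res.S218 := ⊥}`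
keeps `Admissible` (`rfl`) and `Provisos₁₀` (field by field, `contT` included — it reads `θ.ν` only) and WITNESSES ITS OWN Stage-10 record (`isRecordOfRecord₁₀C_of_eq`), at which
the keyed (R₁₀) reads `⊤ → ⊥` at `k = 0` of the run `(1, m, 1)`.  No `N = 1` twin is stated here (a Stage-10 inhabitant over `SU(1)` is dag-n23-b's successor file).
[cite: Balaban1988Convergent, p.244; Balaban1989LargeFieldII, Thm 1 p.355 (bookkeeping census)] -/
theorem not_keyedSlots_rec₁₀C_of_inhabited {F : T4Family} (θ₀ : Stage9Params F N) (h₀ : θ₀.Provisos₁₀) (hθ₀ : θ₀.Admissible) :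
    ¬ ∀ (F' : T4Family) (D : Datum F' N) (w : WorldP), IsRecordOfRecord₁₀C F' N D w →
      ∀ (θ : Stage9Params F' N) (h : θ.Provisos₁₀), θ.Admissible → D = datumOfRecord₁₀ F' N θ h → w.C = D.C → (0 < w.γ ∧ w.γ ≤ θ.γ) →
        w.L = (θ.L : ℝ) → (∀ P, w.up P = upOfRecord₅C F' N (θ.toStage5₁₀ F' N) P) → ∀ P : B12.RunParams,
        (∀ k, k < P.K → TLaw₁₀ F' N θ P k → SLaw₁₀ F' N θ P (k + 1)) ∧
        ((genFlow (betaOfRecord₁₀ F' N θ) P.g0).InInterval w.γ P.K → ∀ k, k ≤ P.K → SLaw₁₀ F' N θ P k →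
          ∀ U : GaugeField (F'.P P.K) k (SU N),
            chiFixed7 F' N θ.ν P.K (gOfRecord₁₀ F' N θ P) k U *
                  Real.exp (-(1 / (gOfRecord₁₀ F' N θ P k) ^ 2 * wilsonBGOfRecord F' N θ.εbg P k U)
                    - w.em (gOfRecord₁₀ F' N θ P k) * (Fintype.card (Site (F'.P P.K) k) : ℝ)) ≤ densOfRecord₁₀ F' N θ P k U ∧
            densOfRecord₁₀ F' N θ P k U ≤ Real.exp (w.ep (gOfRecord₁₀ F' N θ P k) * (Fintype.card (Site (F'.P P.K) k) : ℝ))) := by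
  intro slots
  let θ' : Stage9Params F N :=
    { θ₀ with ScorrLaw := fun _ _ _ => True, res := { θ₀.res with S218 := fun _ _ _ => False } }
  have hθ' : θ'.Admissible := hθ₀
  have h' : θ'.Provisos₁₀ := ⟨h₀.intPiece, h₀.measω, h₀.measChi, h₀.zetaUnity, h₀.zetaAbs, h₀.rstep, h₀.contT⟩
  obtain ⟨w₀⟩ := nonempty_worldP
  have hL1 : (1 : ℝ) < (θ'.L : ℝ) := by exact_mod_cast θ'.hL.2
  let w : WorldP :=
    { w₀ with
      C := (datumOfRecord₁₀ F N θ' h').C, up := fun P => upOfRecord₅C F N (θ'.toStage5₁₀ F N) P, γ := θ'.γ,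
      L := (θ'.L : ℝ), one_lt_L := hL1 }
  have hγ : 0 < w.γ ∧ w.γ ≤ θ'.γ := ⟨hθ'.gamma_pos, le_rfl⟩
  have hrec : IsRecordOfRecord₁₀C F N (datumOfRecord₁₀ F N θ' h') w :=
    isRecordOfRecord₁₀C_of_eq F N θ' h' hθ' w rfl hγ rfl (fun _ => rfl)
  exact (slots F _ w hrec θ' h' hθ' rfl rfl hγ rfl (fun _ => rfl) ⟨1, F.m, 1⟩).1 0 Nat.one_pos True.intro


/-! ## §4 (v1.1) The EXISTENTIALLY-keyed shape (dag-ref-B READ-296's reading pin): the record names SOME law-abiding presentation -/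

/-- **`S_N13 Rec` FROM AN EXISTENTIALLY-KEYED ₉-PRESENTATION OF EVERY `Rec`-RECORD** (dag-ref-B READ-296's reading pin, the shape in which (R₉) is genuine law transport):
for every `Rec`-record `(F, D, w)` SOME `θ, h` with `w.C = (datumOfRecord₉ F N θ h).C` and the C-binding `w.up P = upOfRecord₅C F N (θ.toStage5 F N) P` carry (R₉) and (UV₉) at
every run — no quantifier over sisters, no `href` needed.  Module 14's `b16_main_at_record₉` BY NAME.  Count-neutral; NOT a discharge.
[cite: Balaban1989LargeFieldII, Thm 1 p.355, (0.1) pp.355–356, p.387, p.391; Balaban1988Convergent, p.244, Cor. 3 (2.50) p.264] -/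
theorem s_N13_of_laws_exists₉ (Rec : RecordPred N)
    (slots : ∀ (F : T4Family) (D : Datum F N) (w : WorldP), Rec F D w →
      ∃ (θ : Stage9Params F N) (h : θ.Provisos), w.C = (datumOfRecord₉ F N θ h).C ∧ (∀ P, w.up P = upOfRecord₅C F N (θ.toStage5 F N) P) ∧
        ∀ P : B12.RunParams,
        (∀ k, k < P.K → TLaw₉ F N θ P k → SLaw₉ F N θ P (k + 1)) ∧
        ((genFlow (betaOfRecord₉ F N θ) P.g0).InInterval w.γ P.K → ∀ k, k ≤ P.K → SLaw₉ F N θ P k →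
          ∀ U : GaugeField (F.P P.K) k (SU N),
            chiOfRecord F N θ.ν (gOfRecord₉ F N θ P) P.K k U *
                  Real.exp (-(1 / (gOfRecord₉ F N θ P k) ^ 2 * wilsonBGOfRecord F N θ.εbg P k U)
                    - w.em (gOfRecord₉ F N θ P k) * (Fintype.card (Site (F.P P.K) k) : ℝ)) ≤ densOfRecord₉ F N θ P k U ∧
            densOfRecord₉ F N θ P k U ≤ Real.exp (w.ep (gOfRecord₉ F N θ P k) * (Fintype.card (Site (F.P P.K) k) : ℝ)))) :
    S_N13 Rec := by
  intro F D w hR P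
  obtain ⟨θ, h, hC, hup, hRU⟩ := slots F D w hR
  exact B16NodeKnitRecord9.b16_main_at_record₉ F N θ w P h hC (hup P) (hRU P).1 le_rfl (hRU P).2

/-- **The same at Stage 10** (`Provisos₁₀`, `datumOfRecord₁₀`, `toStage5₁₀`, `SLaw₁₀ ∕ TLaw₁₀`, χ face `chiFixed7`; module 16's `b16_main_at_record₁₀` BY NAME).
[cite: Balaban1989LargeFieldII, Thm 1 p.355, (0.1) pp.355–356, p.387, p.391; Balaban1988Convergent, p.244, Cor. 3 (2.50) p.264] -/
theorem s_N13_of_laws_exists₁₀ (Rec : RecordPred N)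
    (slots : ∀ (F : T4Family) (D : Datum F N) (w : WorldP), Rec F D w →
      ∃ (θ : Stage9Params F N) (h : θ.Provisos₁₀), w.C = (datumOfRecord₁₀ F N θ h).C ∧ (∀ P, w.up P = upOfRecord₅C F N (θ.toStage5₁₀ F N) P) ∧
        ∀ P : B12.RunParams,
        (∀ k, k < P.K → TLaw₁₀ F N θ P k → SLaw₁₀ F N θ P (k + 1)) ∧
        ((genFlow (betaOfRecord₁₀ F N θ) P.g0).InInterval w.γ P.K → ∀ k, k ≤ P.K → SLaw₁₀ F N θ P k →
          ∀ U : GaugeField (F.P P.K) k (SU N),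
            chiFixed7 F N θ.ν P.K (gOfRecord₁₀ F N θ P) k U *
                  Real.exp (-(1 / (gOfRecord₁₀ F N θ P k) ^ 2 * wilsonBGOfRecord F N θ.εbg P k U)
                    - w.em (gOfRecord₁₀ F N θ P k) * (Fintype.card (Site (F.P P.K) k) : ℝ)) ≤ densOfRecord₁₀ F N θ P k U ∧
            densOfRecord₁₀ F N θ P k U ≤ Real.exp (w.ep (gOfRecord₁₀ F N θ P k) * (Fintype.card (Site (F.P P.K) k) : ℝ)))) :
    S_N13 Rec := by
  intro F D w hR P
  obtain ⟨θ, h, hC, hup, hRU⟩ := slots F D w hR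
  exact B16NodeKnitRecord10.b16_main_at_record₁₀ F N θ w P h hC (hup P) (hRU P).1 le_rfl (hRU P).2

end Summit.QuantumFields.YangMills.BalabanUVNodes.N13AtRecord9Keyed

end
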